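import Literature.Computability.Complexity.TFNPClasses
import HarnessLib

/-!
# The collapse `EOPL = PLS ∩ PPAD` (Göös–Hollender–Jain–Maystre–Pires–Robere–Tao 2022) — named fact

Split off from `Literature/Computability/Complexity/TFNPClasses.lean` (refactor `wi-38313`): that
file defines the classes `PPAD`, `PLS`, `EOPL` (closures of END-OF-LINE, LOCALOPT,
END-OF-POTENTIAL-LINE under promise-preserving polynomial-time many-one reductions) and proves their
elementary properties; the one UNPROVED named fact it used to carry, the collapse

* `EOPL_eq_PLS_inter_PPAD` — **Göös et al. (2022), Thm. 1: `EOPL = PLS ∩ PPAD`** (with its two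
  corollaries `.mem_PLS_and_mem_PPAD`, `.reducible_endOfPotentialLine`, proved from the fact),

now lives here, byte-identical and under the same fully-qualified names, so that importing the
classes file does not put this fact into a route's module cone (route `PneNP/ArnoldMorseDeficit`).
Nothing consumes the fact at present; proving it means formalising GHJMPRT 2022 §5 (the reduction
`SoD ⋏ EoL ≤ EoPL`).  The elementary inclusion `EOPL ⊆ PPAD` is PROVED in `TFNPClasses.lean`
(`EOPL_subset_PPAD`).

## References

* M. Göös, A. Hollender, S. Jain, G. Maystre, W. Pires, R. Robere, R. Tao, *Further collapses in
  TFNP*, CCC 2022, Thm. 1. [GoosEtAl2022FurtherCollapses]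
* J. Fearnley, P. Goldberg, A. Hollender, R. Savani, *The complexity of gradient descent:
  CLS = PPAD ∩ PLS*, J. ACM 70 (2022), Thm. 1.1. [FearnleyGoldbergHollenderSavani2022]
-/

namespace Literature.Computability.Complexity

open _root_.Computability

/-! ### The collapse -/

/-- **Göös–Hollender–Jain–Maystre–Pires–Robere–Tao (2022), Theorem 1: `EOPL = PLS ∩ PPAD`.**
("We show `EOPL = PLS ∩ PPAD`. Here the class `EOPL` consists of all total search problems that
reduce to the End-of-Potential-Line problem"; proof: `EOPL ⊆ PLS ∩ PPAD` is immediate from the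
definitions (FGMS 2020), and `PLS ∩ PPAD ⊆ EOPL` by the reduction `SoD ⋏ EoL ≤ EoPL`, loc. cit.
§5, Lemma 4.)  Together with Fearnley–Goldberg–Hollender–Savani (2022), Thm. 1.1
(`CLS = PPAD ∩ PLS`) this is the collapse `EOPL = CLS = PPAD ∩ PLS`.  Over the tree's classes
`EOPL = TFNP.closureOf END-OF-POTENTIAL-LINE`, `PLS = TFNP.closureOf LOCALOPT`,
`PPAD = TFNP.closureOf END-OF-LINE` (promise-preserving polynomial-time many-one reductions).
Named fact (D-0014); users take `(h : EOPL_eq_PLS_inter_PPAD)`.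
[cite: GoosEtAl2022FurtherCollapses, Thm. 1] [cite: FearnleyGoldbergHollenderSavani2022, Thm. 1.1 (CLS = PPAD ∩ PLS)] -/
def EOPL_eq_PLS_inter_PPAD : Prop :=
  EOPL = PLS ∩ PPAD

/-- From the collapse: an `EOPL` problem lies in `PLS` and in `PPAD`.
[cite: GoosEtAl2022FurtherCollapses, Thm. 1] -/
theorem EOPL_eq_PLS_inter_PPAD.mem_PLS_and_mem_PPAD (h : EOPL_eq_PLS_inter_PPAD)
    {R : SearchProblem} (hR : R ∈ EOPL) : R ∈ PLS ∧ R ∈ PPAD := by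
  unfold EOPL_eq_PLS_inter_PPAD at h
  rw [h] at hR
  exact hR

/-- From the collapse: a problem in both `PLS` and `PPAD` reduces to END-OF-POTENTIAL-LINE.
[cite: GoosEtAl2022FurtherCollapses, Thm. 1 (the inclusion PLS ∩ PPAD ⊆ EOPL, §5)] -/
theorem EOPL_eq_PLS_inter_PPAD.reducible_endOfPotentialLine (h : EOPL_eq_PLS_inter_PPAD)
    {R : SearchProblem} (hPLS : R ∈ PLS) (hPPAD : R ∈ PPAD) :
    R.ManyOneReducible TFNP.EndOfPotentialLine := by
  unfold EOPL_eq_PLS_inter_PPAD at h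
  have hR : R ∈ EOPL := by rw [h]; exact ⟨hPLS, hPPAD⟩
  exact hR.2

end Literature.Computability.Complexity
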